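import Summits.ABC.ABC.Theses.IneffectiveSubspace

/-!
# `CanonicalTowerLift` (stmt-ABC-1654, route ABC/IneffectiveSubspace) — Vojta's canonical lift

This file proves the support item `CanonicalTowerLift` of the route file
`Summits/ABC/ABC/Theses/IneffectiveSubspace.lean`:

for `n ≥ 1` and `a ≥ 1` there is `x : Fin n → ℕ`, all `xᵢ ≥ 1`, with `Π xᵢ^(i+1) = a` and
`(Π xᵢ)ⁿ ≤ rad(a)ⁿ · a` (`rad = UniqueFactorizationMonoid.radical` in `ℕ`).

**Construction** (Vojta 2000 §3.1; Vojta CIME 2011, proof of Thm 31.1).  Write `v_p = ord_p a`.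
Put `q = Π_p p^⌊v_p/n⌋` at the top exponent `n` (index `n − 1`, as a `Pi.mulSingle` spike) and, at
exponent `k` (`1 ≤ k ≤ n`, index `k − 1`), the squarefree number `r_k = Π_{p ∣ a, v_p ≡ k (mod n)} p`
(the class `k = n` is empty).  Then
* `Π xᵢ^(i+1) = qⁿ · Π_k r_kᵏ = Π_p p^(n⌊v_p/n⌋ + (v_p mod n)) = a` (fiberwise regrouping of the
  prime factors by `v_p mod n`, `CanonicalTowerLift.prod_fin_filter_mod`), and
* `Π xᵢ = q · Π_k r_k` with `Π_k r_k = Π_{v_p mod n ≠ 0} p ∣ rad a` and `qⁿ ≤ Π p^(v_p) = a`, so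
  `(Π xᵢ)ⁿ ≤ rad(a)ⁿ · a`.

Sources: P. Vojta, *On the ABC conjecture and diophantine approximation by rational points*,
Amer. J. Math. 122 (2000), §3.1 [Vojta2000ABC]; P. Vojta, *Diophantine approximation and Nevanlinna
theory*, CIME LNM 2009 (2011), proof of Thm 31.1 [Vojta2011CIME].  The Lean proof is the candidate
proof attached to the item by the cdisprove seat of crux stmt-ABC-1647 (`Cruxes/TowerExponentWindow/
Disproof.lean`, `canonicalTowerLift`), moved under `Theorems/` with the theorem typed literally as the
route decl.  Uses only Mathlib (`Nat.factorization`, `Nat.primeFactors`,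
`Nat.radical_eq_prod_primeFactors`).  Deliberately NOT here: the use of the lift in `Assembly` /
`WindowGivesPolynomialAbc` (other items of the route).
-/

-- `Summit.<Summit>.<Problem>` is the mandated summit-side namespace (CONVENTIONS §2); for the
-- single-conjunct summit `ABC` the two coincide, so the duplicate `ABC.ABC` is deliberate.
set_option linter.dupNamespace false

namespace Summit.ABC.ABC.Theorems

open scoped BigOperators
open Finset

/-- Shifted `Fin n`-product against a `range n`-product when the two boundary terms are `1`:
if `T 0 = 1 = T n` then `Π_{i : Fin n} T (i+1) = Π_{k < n} T k`. [folklore] -/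
theorem CanonicalTowerLift.prod_fin_succ_eq_prod_range {n : ℕ} (T : ℕ → ℕ) (h0 : T 0 = 1)
    (hn : T n = 1) :
    ∏ i : Fin n, T (i.val + 1) = ∏ k ∈ Finset.range n, T k := by
  have e1 : ∏ i : Fin n, T (i.val + 1) = ∏ k ∈ Finset.range n, T (k + 1) :=
    Fin.prod_univ_eq_prod_range (fun k => T (k + 1)) n
  have e2 := Finset.prod_range_succ' T n   -- ∏ range (n+1) T = (∏ range n, T (k+1)) * T 0
  have e3 := Finset.prod_range_succ T n    -- ∏ range (n+1) T = (∏ range n, T k) * T n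
  rw [h0, mul_one] at e2
  rw [hn, mul_one] at e3
  rw [e1, ← e2, e3]

/-- Fiberwise regrouping of a product over `s` by the residue classes `v p mod n = k`,
`k = 1, …, n` (the class `k = n` is empty, and the class `0` contributes `1` by hypothesis):
`Π_{i : Fin n} Π_{p ∈ s, v p mod n = i+1} g p (v p mod n) = Π_{p ∈ s} g p (v p mod n)`. [folklore] -/
theorem CanonicalTowerLift.prod_fin_filter_mod {n : ℕ} (hn : 1 ≤ n) (s : Finset ℕ) (v : ℕ → ℕ)
    (g : ℕ → ℕ → ℕ) (hg0 : ∀ p ∈ s, v p % n = 0 → g p (v p % n) = 1) :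
    ∏ i : Fin n, ∏ p ∈ s.filter (fun p => v p % n = i.val + 1), g p (v p % n) =
      ∏ p ∈ s, g p (v p % n) := by
  classical
  have hT0 : (∏ p ∈ s.filter (fun p => v p % n = 0), g p (v p % n)) = 1 := by
    refine Finset.prod_eq_one fun p hp => ?_
    rw [Finset.mem_filter] at hp
    exact hg0 p hp.1 hp.2
  have hTn : (∏ p ∈ s.filter (fun p => v p % n = n), g p (v p % n)) = 1 := by
    have : s.filter (fun p => v p % n = n) = ∅ := by
      refine Finset.filter_eq_empty_iff.mpr fun p _ h => ?_
      have := Nat.mod_lt (v p) (by omega : 0 < n); omega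
    rw [this, Finset.prod_empty]
  have h1 := CanonicalTowerLift.prod_fin_succ_eq_prod_range
    (fun k => ∏ p ∈ s.filter (fun p => v p % n = k), g p (v p % n)) hT0 hTn
  refine h1.trans ?_
  exact Finset.prod_fiberwise_of_maps_to (g := fun p => v p % n) (f := fun p => g p (v p % n))
    fun p _ => Finset.mem_range.mpr (Nat.mod_lt _ (by omega))

/-- **Vojta's canonical lift** (support item `CanonicalTowerLift`, stmt-ABC-1654; Vojta 2000 §3.1,
Vojta CIME 2011 proof of Thm 31.1): for `n ≥ 1` and `a ≥ 1` there is `x : Fin n → ℕ` with all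
`xᵢ ≥ 1`, `Π xᵢ^(i+1) = a` and `(Π xᵢ)ⁿ ≤ rad(a)ⁿ · a`.  Witness: `q = Π_p p^⌊v_p(a)/n⌋` at the top
exponent `n` and `r_k = Π_{v_p(a) ≡ k (mod n)} p` at exponent `k` (`1 ≤ k < n`); then
`Π xᵢ^(i+1) = a` and `(Π xᵢ)ⁿ = qⁿ (Π r_k)ⁿ ≤ a · rad(a)ⁿ`. [cite: Vojta2000ABC, §3.1] -/
theorem canonicalTowerLift_proof : Summit.ABC.ABC.Theses.IneffectiveSubspace.CanonicalTowerLift := by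
  unfold Summit.ABC.ABC.Theses.IneffectiveSubspace.CanonicalTowerLift
  intro n hn a ha
  classical
  set PF := a.primeFactors with hPF
  set q : ℕ := ∏ p ∈ PF, p ^ (a.factorization p / n) with hq
  have ha0 : a ≠ 0 := by omega
  -- `∏_{p ∈ primeFactors a} p ^ v_p(a) = a`
  have hfac : ∏ p ∈ PF, p ^ a.factorization p = a := by
    rw [hPF]
    conv_rhs => rw [← Nat.prod_factorization_pow_eq_self ha0,
      Nat.prod_factorization_eq_prod_primeFactors]
  have hprime : ∀ p ∈ PF, p.Prime := fun p hp => Nat.prime_of_mem_primeFactors hp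
  have hqpos : 0 < q := Finset.prod_pos fun p hp => pow_pos (hprime p hp).pos _
  have hrpos : ∀ k, 0 < ∏ p ∈ PF.filter (fun p => a.factorization p % n = k), p := fun k =>
    Finset.prod_pos fun p hp => (hprime p (Finset.mem_filter.mp hp).1).pos
  let jt : Fin n := ⟨n - 1, by omega⟩
  refine ⟨fun i => (Pi.mulSingle jt q : Fin n → ℕ) i *
      ∏ p ∈ PF.filter (fun p => a.factorization p % n = i.val + 1), p, fun i => ?_, ?_, ?_⟩
  · -- positivity
    refine Nat.mul_pos ?_ (hrpos _)
    rcases eq_or_ne i jt with rfl | h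
    · simp [hqpos]
    · simp [Pi.mulSingle_eq_of_ne h]
  · -- the product is `a`
    have hsplit : (∏ i : Fin n, ((Pi.mulSingle jt q : Fin n → ℕ) i *
        ∏ p ∈ PF.filter (fun p => a.factorization p % n = i.val + 1), p) ^ (i.val + 1)) =
        (∏ i : Fin n, ((Pi.mulSingle jt q : Fin n → ℕ) i) ^ (i.val + 1)) *
          ∏ i : Fin n, (∏ p ∈ PF.filter (fun p => a.factorization p % n = i.val + 1), p) ^
            (i.val + 1) := by
      rw [← Finset.prod_mul_distrib]; congr 1; ext i; ring
    have hspike : (∏ i : Fin n, ((Pi.mulSingle jt q : Fin n → ℕ) i) ^ (i.val + 1)) = q ^ n := by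
      rw [Finset.prod_eq_single jt]
      · simp [jt, Nat.sub_add_cancel hn]
      · intro b _ hb; simp [Pi.mulSingle_eq_of_ne hb]
      · intro h; exact absurd (Finset.mem_univ _) h
    have hres : (∏ i : Fin n, (∏ p ∈ PF.filter (fun p => a.factorization p % n = i.val + 1), p) ^
        (i.val + 1)) = ∏ p ∈ PF, p ^ (a.factorization p % n) := by
      have step : ∀ i : Fin n,
          (∏ p ∈ PF.filter (fun p => a.factorization p % n = i.val + 1), p) ^ (i.val + 1) =
          ∏ p ∈ PF.filter (fun p => a.factorization p % n = i.val + 1),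
            p ^ (a.factorization p % n) := by
        intro i
        rw [← Finset.prod_pow]
        refine Finset.prod_congr rfl fun p hp => ?_
        rw [(Finset.mem_filter.mp hp).2]
      rw [Finset.prod_congr rfl fun i _ => step i]
      exact CanonicalTowerLift.prod_fin_filter_mod hn PF (fun p => a.factorization p)
        (fun p e => p ^ e) fun p _ h0 => by rw [h0, pow_zero]
    rw [hsplit, hspike, hres, hq, ← Finset.prod_pow, ← Finset.prod_mul_distrib]
    have : ∀ p ∈ PF, (p ^ (a.factorization p / n)) ^ n * p ^ (a.factorization p % n) =
        p ^ (a.factorization p) := fun p _ => by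
      rw [← pow_mul, ← pow_add]; congr 1; rw [mul_comm]; exact Nat.div_add_mod _ n
    rw [Finset.prod_congr rfl this]
    exact hfac
  · -- the bound (Π xᵢ)ⁿ ≤ rad(a)ⁿ · a
    have hprodx : (∏ i : Fin n, ((Pi.mulSingle jt q : Fin n → ℕ) i *
        ∏ p ∈ PF.filter (fun p => a.factorization p % n = i.val + 1), p)) =
        q * ∏ i : Fin n, ∏ p ∈ PF.filter (fun p => a.factorization p % n = i.val + 1), p := by
      rw [Finset.prod_mul_distrib, Fintype.prod_pi_mulSingle']
    have hR' : (∏ i : Fin n, ∏ p ∈ PF.filter (fun p => a.factorization p % n = i.val + 1), p) =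
        ∏ p ∈ PF.filter (fun p => a.factorization p % n ≠ 0), p := by
      have key := CanonicalTowerLift.prod_fin_filter_mod hn PF (fun p => a.factorization p)
        (fun p e => if e = 0 then 1 else p) fun p _ h0 => by rw [h0]; rfl
      have step : ∀ i : Fin n,
          (∏ p ∈ PF.filter (fun p => a.factorization p % n = i.val + 1), p) =
          ∏ p ∈ PF.filter (fun p => a.factorization p % n = i.val + 1),
            (if a.factorization p % n = 0 then 1 else p) := by
        intro i
        refine Finset.prod_congr rfl fun p hp => ?_
        rw [(Finset.mem_filter.mp hp).2]; simp
      rw [Finset.prod_congr rfl fun i _ => step i, key, Finset.prod_filter]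
      refine Finset.prod_congr rfl fun p _ => ?_
      by_cases h : a.factorization p % n = 0 <;> simp [h]
    have hR : (∏ i : Fin n, ∏ p ∈ PF.filter (fun p => a.factorization p % n = i.val + 1), p) ∣
        UniqueFactorizationMonoid.radical a := by
      rw [hR', Nat.radical_eq_prod_primeFactors]
      exact Finset.prod_dvd_prod_of_subset _ _ _ (Finset.filter_subset _ _)
    have hRle := Nat.le_of_dvd (Nat.radical_pos a) hR
    have hqn : q ^ n ≤ a := by
      rw [hq, ← Finset.prod_pow]
      calc ∏ p ∈ PF, (p ^ (a.factorization p / n)) ^ n ≤ ∏ p ∈ PF, p ^ (a.factorization p) := by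
            refine Finset.prod_le_prod' fun p hp => ?_
            rw [← pow_mul]
            exact Nat.pow_le_pow_right (hprime p hp).pos (Nat.div_mul_le_self _ _)
        _ = a := hfac
    rw [hprodx, mul_pow, mul_comm]
    exact Nat.mul_le_mul (Nat.pow_le_pow_left hRle n) hqn

end Summit.ABC.ABC.Theorems
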